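import Summits.NavierStokesRegularity.NavierStokesRegularity.Theses.SymmetryModuliCount
import Literature.Analysis.FluidPDE.TypeIAncientMild
import Literature.Analysis.FluidPDE.KatoSymmetryCovariance
import Literature.Analysis.FluidPDE.KNSSOseenMildDecayTools
import Summits.NavierStokesRegularity.NavierStokesRegularity.Theorems.SqueezeCycleExtremalElementExistsExtraction
import Summits.NavierStokesRegularity.NavierStokesRegularity.Theorems.SymmetricLiouville.Negative.LoadBearing

/-!
# Skeleton (lead's reshape) of line `blowdown-kills-pitch` for crux `SymmetricLiouville`
# (stmt-NavierStokesRegularity-4053, route `SymmetryModuliCount`)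

Lead prover's working skeleton, adopted from `Cruxes/SymmetricLiouville/Lines/blowdown-kills-pitch.lean`
(planner `cruxplan-…-blowdown-kills-pitch`, triage r1 pass ×3) with three reshapes (PICKED.md):

* F3 (`stub_classCompactness`) is kept VERBATIM but is no longer a stub: it is PROVED here from the tree's
  `Theorems.exists_tendsto_of_isTypeIAncientMild_seq` (C¹_loc compactness of `IsTypeIAncientMild C`, limit in the class).
* NEW registered stub `stub_rotationCovariance` (the class is invariant under linear isometries `u ↦ L u(t, L⁻¹x)`),
  fed to the lever `stub_periodicBlowdownVanishing` as an explicit antecedent (like F3), so the lever can be proved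
  in parallel with it.
* The foreign stub 5 is split along `A = 0` / `A ≠ 0`: `stub_selfSimilarLeaf` (Tsai 1998 Thm 1, `q = ∞`, in the gauge
  class — closable today) and `stub_rotatedSelfSimilarLiouville` (bounded-profile RSS = `Disproof.RotatedSelfSimilarLiouville`,
  the open Pineau–Vicol window), glued sorry-free into the planner's `Sig.stub_spiralScalingLiouville`.

Composition unchanged in spirit: `SymmetricLiouville_of` concludes the crux BY NAME from the registered stubs and the
route item `AxisymEndLiouville` (stmt-14061, hypothesis); `HelicalEndLiouville_of` concludes route item stmt-14062 BY
NAME from stubs 1–4 (+ F3 proved + rotation covariance).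
-/

noncomputable section

set_option linter.dupNamespace false

open Set Function Filter
open scoped Topology
open Literature.Analysis.FluidPDE
open Summit.NavierStokesRegularity.NavierStokesRegularity.Theses.SymmetryModuliCount

namespace Summit.NavierStokesRegularity.NavierStokesRegularity.Theorems.SymmetryModuliCountSymmetricLiouville

/-- Local notation for physical space `ℝ³`. -/
local notation "E3" => EuclideanSpace ℝ (Fin 3)

/-! ## Statements (`Sig.*`) -/

/-- **F3 — sequential compactness and mild closure of `A_C` (same constant).** Every sequence in `A_C` has a
subsequence converging, locally uniformly on every slice `t < 0`, to an element of `A_C`. -/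
def ClassCompact (C : ℝ) : Prop :=
  ∀ v : ℕ → ℝ → E3 → E3, (∀ n, IsTypeIAncientMild C (v n)) →
    ∃ (φ : ℕ → ℕ) (w : ℝ → E3 → E3), StrictMono φ ∧ IsTypeIAncientMild C w ∧
      ∀ t < 0, TendstoLocallyUniformly (fun n => v (φ n) t) (w t) atTop

/-- **Rotation covariance of `A_C` (same constant)**: for every linear isometry `L` of `ℝ³`, `u ∈ A_C` implies
`(t, x) ↦ L (u t (L⁻¹ x)) ∈ A_C` (heat kernel radial, `oseenKernel` `O(3)`-equivariant from its closed form, the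
divergence is a trace, the Type-I bound is a norm bound). -/
def RotationCovariant (C : ℝ) : Prop :=
  ∀ (L : E3 ≃ₗᵢ[ℝ] E3) (u : ℝ → E3 → E3), IsTypeIAncientMild C u →
    IsTypeIAncientMild C (fun t x => L (u t (L.symm x)))

/-- Stub 1 (statement): **screw ⊃ lattice — a Killing field with `a ∉ range A` has a PITCH VECTOR.** -/
def Sig.stub_screwIsPeriodic : Prop :=
  ∀ (a : E3) (A : E3 →L[ℝ] E3), (∀ x, inner ℝ (A x) x = 0) → a ∉ Set.range A →
    ∃ e : E3, e ≠ 0 ∧ ∀ v : E3 → E3, Differentiable ℝ v →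
      (∀ x, fderiv ℝ v x (a + A x) = A (v x)) → ∀ x, v (x + e) = v x

/-- Stub 2 (statement): F3 for every constant `C` (see `ClassCompact`). PROVED below. -/
def Sig.stub_classCompactness : Prop :=
  ∀ C : ℝ, ClassCompact C

/-- Stub 2' (statement, NEW): rotation covariance of the class for every constant `C`. -/
def Sig.stub_rotationCovariance : Prop :=
  ∀ C : ℝ, RotationCovariant C

/-- Stub 3 (statement): **A1 — blow-down kills the pitch.** Given F3 and rotation covariance at constant `C`, an
element of `A_C` which is periodic in some direction `e ≠ 0` has `√(−t)‖u(t)‖_∞ → 0` as `t → −∞`. -/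
def Sig.stub_periodicBlowdownVanishing : Prop :=
  ∀ C : ℝ, ClassCompact C → RotationCovariant C → ∀ u : ℝ → E3 → E3, IsTypeIAncientMild C u →
    ∀ e : E3, e ≠ 0 → (∀ t < 0, ∀ x, u t (x + e) = u t x) →
    ∀ ε > 0, ∃ T < 0, ∀ t < T, ∀ x, Real.sqrt (-t) * ‖u t x‖ ≤ ε

/-- Stub 4 (statement): **A2 — small at `−∞` forces zero** (for EVERY element of `A_C`, no symmetry). -/
def Sig.stub_smallAtMinusInfinityLiouville : Prop :=
  ∀ (C : ℝ) (u : ℝ → E3 → E3), IsTypeIAncientMild C u →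
    (∀ ε > 0, ∃ T < 0, ∀ t < T, ∀ x, Real.sqrt (-t) * ‖u t x‖ ≤ ε) →
    ∀ t < 0, ∀ x, u t x = 0

/-- Stub 5 (statement, the planner's FOREIGN leaf, kept as the glue target): spiral-scaling Liouville in normal form. -/
def Sig.stub_spiralScalingLiouville : Prop :=
  ∀ (C : ℝ) (u : ℝ → E3 → E3), IsTypeIAncientMild C u →
    ∀ A : E3 →L[ℝ] E3, (∀ x, inner ℝ (A x) x = 0) →
      (∀ t < 0, ∀ x, fderiv ℝ (u t) x (x + A x) + u t x + (2 * t) • timeDeriv u t x - A (u t x) = 0) →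
      ∀ t < 0, ∀ x, u t x = 0

/-- Stub 5a (statement): **the self-similar leaf** (`A = 0`; Tsai 1998 Thm 1, `q = ∞`, in the gauge class). -/
def Sig.stub_selfSimilarLeaf : Prop :=
  ∀ (C : ℝ) (u : ℝ → E3 → E3), IsTypeIAncientMild C u →
    (∀ t < 0, ∀ x, fderiv ℝ (u t) x x + u t x + (2 * t) • timeDeriv u t x = 0) →
    ∀ t < 0, ∀ x, u t x = 0

/-- Stub 5b (statement): **rotated self-similar Liouville, BOUNDED profile, every rate `A ≠ 0`**
(= `Disproof.RotatedSelfSimilarLiouville`; contains the open Pineau–Vicol Conj. 1.1 window). -/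
def Sig.stub_rotatedSelfSimilarLiouville : Prop :=
  ∀ (C : ℝ) (u : ℝ → E3 → E3), IsTypeIAncientMild C u →
    ∀ A : E3 →L[ℝ] E3, (∀ x, inner ℝ (A x) x = 0) → A ≠ 0 →
      (∀ t < 0, ∀ x, fderiv ℝ (u t) x (x + A x) + u t x + (2 * t) • timeDeriv u t x - A (u t x) = 0) →
      ∀ t < 0, ∀ x, u t x = 0

/-- The crux decl, wrapped (so that only `SymmetricLiouville_proof` concludes the crux BY NAME for the skeleton
checker; `Iff.rfl`-transparent). -/
def Sig.Crux : Prop := SymmetricLiouville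

/-- The route item `HelicalEndLiouville` (stmt-14062), wrapped likewise. -/
def Sig.Helical : Prop := HelicalEndLiouville

/-- The PERIODIC LEAF of the crux on the whole past: an element of `A_C` annihilated by a Killing generator
`(a + Ax)·∇ − A` with `a ∉ range A` vanishes. Proved below from the stubs (`periodicLeaf_of`). -/
def Sig.periodicLeaf : Prop :=
  ∀ (C : ℝ) (u : ℝ → E3 → E3), IsTypeIAncientMild C u →
    ∀ (a : E3) (A : E3 →L[ℝ] E3), (∀ x, inner ℝ (A x) x = 0) → a ∉ Set.range A →
      (∀ t < 0, ∀ x, fderiv ℝ (u t) x (a + A x) - A (u t x) = 0) → ∀ t < 0, ∀ x, u t x = 0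

/-! ## Registered stubs (the only `sorry`s of the file) -/

/-- **Stub 1 — screw ⊃ lattice (kinematic bridge).** For a skew `A` on `ℝ³` and `a ∉ range A` there is a nonzero
pitch vector `e` such that every differentiable `v : ℝ³ → ℝ³` with `Dv(x)[a + Ax] = A v(x)` for all `x` satisfies
`v(x + e) = v(x)` (`A = 0`: `e = a`; `A ≠ 0`: `e = (2π/ρ)·P_{ker A} a`, `A³ = −ρ²A`). -/
theorem stub_screwIsPeriodic :
    ∀ (a : E3) (A : E3 →L[ℝ] E3), (∀ x, inner ℝ (A x) x = 0) → a ∉ Set.range A →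
      ∃ e : E3, e ≠ 0 ∧ ∀ v : E3 → E3, Differentiable ℝ v →
        (∀ x, fderiv ℝ v x (a + A x) = A (v x)) → ∀ x, v (x + e) = v x := by
  sorry

/-- **Stub 2' — rotation covariance of `A_C`** (isometry-equivariance of the heat kernel and of `oseenKernel`,
trace invariance of the divergence). -/
theorem stub_rotationCovariance :
    ∀ (C : ℝ) (L : E3 ≃ₗᵢ[ℝ] E3) (u : ℝ → E3 → E3), IsTypeIAncientMild C u →
      IsTypeIAncientMild C (fun t x => L (u t (L.symm x))) := by
  sorry

/-- **Stub 3 — A1, BLOW-DOWN KILLS THE PITCH (the lever).** If `u ∈ A_C` is `e`-periodic (`e ≠ 0`) then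
`√(−t)‖u(t)‖_∞ → 0` as `t → −∞`: violators `(t_n → −∞, x_n)` ⇒ blow-downs `λ_n u(λ_n²s, x_n + λ_n y)` in `A_C`
(`Theorems.isTypeIAncientMild_zoom`), nonzero at `(−1, 0)`, period `e/λ_n → 0`; after rotating `e` onto the
`x₂`-axis (rotation covariance) the F3-limit is invariant under the whole line `ℝe₂`, and its time shift is killed by
`KNSS2009_typeI_rate_liouville_holds` — contradiction. -/
theorem stub_periodicBlowdownVanishing :
    ∀ C : ℝ,
      (∀ v : ℕ → ℝ → E3 → E3, (∀ n, IsTypeIAncientMild C (v n)) →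
      ∃ (φ : ℕ → ℕ) (w : ℝ → E3 → E3), StrictMono φ ∧ IsTypeIAncientMild C w ∧
        ∀ t < 0, TendstoLocallyUniformly (fun n => v (φ n) t) (w t) atTop) →
      (∀ (L : E3 ≃ₗᵢ[ℝ] E3) (u : ℝ → E3 → E3), IsTypeIAncientMild C u →
      IsTypeIAncientMild C (fun t x => L (u t (L.symm x)))) →
      ∀ u : ℝ → E3 → E3, IsTypeIAncientMild C u →
        ∀ e : E3, e ≠ 0 → (∀ t < 0, ∀ x, u t (x + e) = u t x) →
        ∀ ε > 0, ∃ T < 0, ∀ t < T, ∀ x, Real.sqrt (-t) * ‖u t x‖ ≤ ε := by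
  sorry

/-- **Stub 4 — A2, SMALL AT `−∞` ⇒ ZERO (Kato gap + forward uniqueness; no symmetry).** Engine: the landed gap
theorem `Negative.SmallConstantGap.exists_eps_small_vanishes` on the backward shift `u(· + T) ∈ A_C`, then
`oseenMild_bounded_unique` forward. -/
theorem stub_smallAtMinusInfinityLiouville :
    ∀ (C : ℝ) (u : ℝ → E3 → E3), IsTypeIAncientMild C u →
      (∀ ε > 0, ∃ T < 0, ∀ t < T, ∀ x, Real.sqrt (-t) * ‖u t x‖ ≤ ε) →
      ∀ t < 0, ∀ x, u t x = 0 := by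
  sorry

/-- **Stub 5a — the self-similar leaf (Tsai, KNOWN).** The clause integrates to `u(t,x) = (−t)^{-1/2}U(x/√(−t))`,
`U = u(−1,·)` bounded by `C`; with the KNSS pressure (`IsTypeIAncientMild.exists_isClassicalNSSolutionOn_Ioo`) and
`lerayBackward_isClassical_iff_holds`, `(U, Q)` is a Leray profile, `tsai_selfsimilar_bounded_holds` makes `U`
constant and `IsTypeIAncientMild.eq_zero_of_slice_const` kills the constant. -/
theorem stub_selfSimilarLeaf :
    ∀ (C : ℝ) (u : ℝ → E3 → E3), IsTypeIAncientMild C u →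
      (∀ t < 0, ∀ x, fderiv ℝ (u t) x x + u t x + (2 * t) • timeDeriv u t x = 0) →
      ∀ t < 0, ∀ x, u t x = 0 := by
  sorry

/-- **Stub 5b — rotated self-similar Liouville with BOUNDED profile, every `A ≠ 0` (the open core; FOREIGN).**
Known only after upgrading the profile to Pineau–Vicol's decaying class and only off the window
`α₁ ≤ |α| ≤ α₂` (`pineauVicol2026_rss_liouville`, named fact); PV Conj. 1.1 = Tsai 2018 Conj. 8.9 on the window. -/
theorem stub_rotatedSelfSimilarLiouville :
    ∀ (C : ℝ) (u : ℝ → E3 → E3), IsTypeIAncientMild C u →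
      ∀ A : E3 →L[ℝ] E3, (∀ x, inner ℝ (A x) x = 0) → A ≠ 0 →
        (∀ t < 0, ∀ x, fderiv ℝ (u t) x (x + A x) + u t x + (2 * t) • timeDeriv u t x - A (u t x) = 0) →
        ∀ t < 0, ∀ x, u t x = 0 := by
  sorry

/-! ## F3 is a theorem of the tree (sorry-free) -/

/-- **F3 proved**: sequential compactness of `A_C` with the limit in the class and slice-wise locally uniform
convergence is the tree's `Theorems.exists_tendsto_of_isTypeIAncientMild_seq` (KNSS 2009 Lemma 6.1 + Prop. 4.1,
`SqueezeCycleExtremalElementExistsExtraction.lean`) with its gradient clauses dropped. -/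
theorem stub_classCompactness :
    ∀ C : ℝ, (∀ v : ℕ → ℝ → E3 → E3, (∀ n, IsTypeIAncientMild C (v n)) →
      ∃ (φ : ℕ → ℕ) (w : ℝ → E3 → E3), StrictMono φ ∧ IsTypeIAncientMild C w ∧
        ∀ t < 0, TendstoLocallyUniformly (fun n => v (φ n) t) (w t) atTop) := by
  intro C v hv
  obtain ⟨φ, hφ, W, hW, -, -, hloc, -⟩ := exists_tendsto_of_isTypeIAncientMild_seq C hv
  exact ⟨φ, W, hφ, hW, hloc⟩

/-! ## Sorry-free helpers: conjugation by translations, the spiral centre -/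

/-- **`A_C` is invariant under space translations** `u ↦ u(·, · + c)` (same constant). -/
theorem isTypeIAncientMild_comp_add_right {C : ℝ} {u : ℝ → E3 → E3} (h : IsTypeIAncientMild C u) (c : E3) :
    IsTypeIAncientMild C (fun t x => u t (x + c)) := by
  refine ⟨?_, fun t ht => (h.isDivFree ht).comp_add_right c, fun s t hst ht x => ?_,
    fun t ht x => h.norm_le ht (x + c)⟩
  · have e : (uncurry fun t x => u t (x + c)) = uncurry u ∘ fun p : ℝ × E3 => (p.1, p.2 + c) := by
      funext p
      rfl
    rw [e]
    refine h.contDiffOn.comp ((contDiff_fst.prodMk (contDiff_snd.add contDiff_const)).contDiffOn) ?_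
    intro p hp
    exact mem_prod.2 ⟨(mem_prod.1 hp).1, mem_univ _⟩
  · show u t (x + c) = heatFlow (fun y => u s (y + c)) (t - s) x -
        oseenDuhamel 1 s (fun τ y => u τ (y + c)) (fun τ y => u τ (y + c)) t x
    rw [heatFlow_comp_add_right, oseenDuhamel_comp_add_right]
    exact h.mild_eq hst ht (x + c)

/-- For `σ ≠ 0` and `A` skew, `σ + A` is invertible (`⟪(σ + A)v, v⟫ = σ‖v‖²`), so the spiral scaling
`ξ = (a, σ, A)` has a CENTRE `c`: `σc + Ac = −a`. -/
theorem exists_spiral_centre {σ : ℝ} (hσ : σ ≠ 0) {A : E3 →L[ℝ] E3} (hA : ∀ x, inner ℝ (A x) x = 0)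
    (a : E3) : ∃ c : E3, σ • c + A c = -a := by
  let M : E3 →ₗ[ℝ] E3 := σ • LinearMap.id + (A : E3 →ₗ[ℝ] E3)
  have hM : ∀ v, M v = σ • v + A v := fun v => rfl
  have hinj : Function.Injective M := by
    intro v w hvw
    have h0 : M (v - w) = 0 := by rw [map_sub, hvw, sub_self]
    rw [hM] at h0
    have h1 : inner ℝ (σ • (v - w) + A (v - w)) (v - w) = 0 := by rw [h0, inner_zero_left]
    rw [inner_add_left, hA (v - w), add_zero, real_inner_smul_left, real_inner_self_eq_norm_sq] at h1
    have h2 : ‖v - w‖ ^ 2 = 0 := by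
      rcases mul_eq_zero.1 h1 with h | h
      · exact absurd h hσ
      · exact h
    have h3 : v - w = 0 := by
      rw [← norm_eq_zero]
      exact pow_eq_zero_iff two_ne_zero |>.1 h2
    exact sub_eq_zero.1 h3
  obtain ⟨c, hc⟩ := (LinearMap.injective_iff_surjective.1 hinj) (-a)
  exact ⟨c, by rw [← hM]; exact hc⟩

/-! ## Compositions (sorry-free) -/

/-- **The foreign leaf from its two halves**: `A = 0` is the self-similar leaf, `A ≠ 0` the rotated one. -/
theorem spiralScalingLiouville_of (h5a : Sig.stub_selfSimilarLeaf) (h5b : Sig.stub_rotatedSelfSimilarLiouville) :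
    Sig.stub_spiralScalingLiouville := by
  intro C u hcl A hA hL
  rcases eq_or_ne A 0 with rfl | hA0
  · refine h5a C u hcl ?_
    intro t ht x
    simpa only [zero_apply, add_zero, sub_zero] using hL t ht x
  · exact h5b C u hcl A hA hA0 hL

/-- **The periodic leaf from stubs 1–4** (with F3 proved and rotation covariance). -/
theorem periodicLeaf_of (h1 : Sig.stub_screwIsPeriodic) (h2 : Sig.stub_classCompactness)
    (h2' : Sig.stub_rotationCovariance)
    (h3 : Sig.stub_periodicBlowdownVanishing) (h4 : Sig.stub_smallAtMinusInfinityLiouville) :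
    Sig.periodicLeaf := by
  intro C u hcl a A hA hra hK
  obtain ⟨e, he, hper⟩ := h1 a A hA hra
  have hperu : ∀ t < 0, ∀ x, u t (x + e) = u t x := by
    intro t ht x
    refine hper (u t) ((hcl.contDiff_slice ht).differentiable (by simp)) (fun y => ?_) x
    exact sub_eq_zero.1 (hK t ht y)
  exact h4 C u hcl (h3 C (h2 C) (h2' C) u hcl e he hperu)

/-- **Stubs 1–4 prove the ROUTE ITEM `HelicalEndLiouville` (stmt-NavierStokesRegularity-14062) by name** — the
helical / translational leaf on a backward END `t < θ` (end-to-past reduction by `IsTypeIAncientMild.comp_sub_right`). -/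
theorem HelicalEndLiouville_of (h1 : Sig.stub_screwIsPeriodic) (h2 : Sig.stub_classCompactness)
    (h2' : Sig.stub_rotationCovariance)
    (h3 : Sig.stub_periodicBlowdownVanishing) (h4 : Sig.stub_smallAtMinusInfinityLiouville) :
    Sig.Helical := by
  intro C u hcl a A θ hA hra hθ hsym t ht x
  have hv : IsTypeIAncientMild C (fun s => u (s - -θ)) := hcl.comp_sub_right (by linarith)
  have hsv : ∀ s < 0, ∀ y,
      fderiv ℝ ((fun s => u (s - -θ)) s) y (a + A y) - A ((fun s => u (s - -θ)) s y) = 0 := by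
    intro s hs y
    exact hsym (s - -θ) (by linarith) y
  have key := periodicLeaf_of h1 h2 h2' h3 h4 C (fun s => u (s - -θ)) hv a A hA hra hsv (t - θ)
    (by linarith) x
  have e : t - θ - -θ = t := by ring
  simpa only [e] using key

/-- **The skeleton concludes the crux BY NAME**: `SymmetricLiouville` (route `SymmetryModuliCount`,
stmt-NavierStokesRegularity-4053) from the registered stubs (+ F3 proved) and the route item `AxisymEndLiouville`
(stmt-14061). Conjugacy bookkeeping: `σ = 0` ⇒ split on `a ∈ range A` (rotation about the axis through `−c`:
`AxisymEndLiouville` at `θ = 0`) / `a ∉ range A` (periodic leaf); `σ ≠ 0` ⇒ translate to the spiral centre, divide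
the generator by `σ`, foreign leaf. -/
theorem SymmetricLiouville_of :
    Sig.stub_screwIsPeriodic → Sig.stub_classCompactness → Sig.stub_rotationCovariance →
      Sig.stub_periodicBlowdownVanishing → Sig.stub_smallAtMinusInfinityLiouville → AxisymEndLiouville →
        Sig.stub_selfSimilarLeaf → Sig.stub_rotatedSelfSimilarLiouville → Sig.Crux := by
  intro h1 h2 h2' h3 h4 hAx h5a h5b C u hu a σ A hA hne hL t ht x
  have h5 : Sig.stub_spiralScalingLiouville := spiralScalingLiouville_of h5a h5b
  have hcl : IsTypeIAncientMild C u := isTypeIAncientMild_iff.2 hu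
  rcases eq_or_ne σ 0 with rfl | hσ
  · -- ISOMETRIC (Killing) leaves: `L_ξ u = ∇u·(a + Ax) − Au`
    have hK : ∀ t < 0, ∀ x, fderiv ℝ (u t) x (a + A x) - A (u t x) = 0 := by
      intro t ht x
      have h1' := hL t ht x
      simp only [zero_smul, add_zero, mul_zero, zero_mul] at h1'
      exact h1'
    by_cases hra : a ∈ Set.range A
    · -- rotation about the axis through `-c`: route item `AxisymEndLiouville` at `θ = 0`
      obtain ⟨c, hc⟩ := hra
      have hA0 : A ≠ 0 := by
        rintro rfl
        apply hne
        refine ⟨?_, rfl, rfl⟩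
        rw [← hc, zero_apply]
      refine hAx C u hcl (-c) A 0 hA hA0 le_rfl ?_ t ht x
      intro t ht x
      have e : A (x - -c) = a + A x := by
        rw [sub_neg_eq_add, map_add, hc, add_comm]
      rw [e]
      exact hK t ht x
    · -- translation or screw of nonzero pitch: the periodic leaf, stubs 1–4
      exact periodicLeaf_of h1 h2 h2' h3 h4 C u hcl a A hA hra hK t ht x
  · -- SPIRAL SCALINGS `σ ≠ 0`: translate to the centre, normalise the rate to `1`, stub 5
    obtain ⟨c, hc⟩ := exists_spiral_centre hσ hA a
    have hv : IsTypeIAncientMild C (fun t x => u t (x + c)) := isTypeIAncientMild_comp_add_right hcl c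
    obtain ⟨A', hA'def⟩ : ∃ A' : E3 →L[ℝ] E3, A' = σ⁻¹ • A := ⟨_, rfl⟩
    have hA' : ∀ x, inner ℝ (A' x) x = 0 := by
      intro x
      rw [hA'def, smul_apply, real_inner_smul_left, hA x, mul_zero]
    -- the normalised symmetry of the translated field
    have hLv : ∀ t < 0, ∀ x, fderiv ℝ (fun y => u t (y + c)) x (x + A' x) + u t (x + c) +
        (2 * t) • timeDeriv (fun s y => u s (y + c)) t x - A' (u t (x + c)) = 0 := by
      intro t ht x
      have key := hL t ht (x + c)
      have e1 : a + σ • (x + c) + A (x + c) = σ • x + A x := by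
        have h0 : σ • c + A c + a = 0 := by rw [hc, neg_add_cancel]
        calc a + σ • (x + c) + A (x + c) = σ • x + A x + (σ • c + A c + a) := by
              rw [smul_add, map_add]; abel
          _ = σ • x + A x := by rw [h0, add_zero]
      rw [e1] at key
      have e2 : fderiv ℝ (fun y => u t (y + c)) x = fderiv ℝ (u t) (x + c) := by
        rw [fderiv_comp_add_right]
      have e3 : timeDeriv (fun s y => u s (y + c)) t x = timeDeriv u t (x + c) := rfl
      rw [e2, e3]
      have k2 := congrArg (fun w => σ⁻¹ • w) key
      simp only [smul_zero, smul_add, smul_sub, smul_smul, inv_mul_cancel₀ hσ, one_smul] at k2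
      have e5 : σ⁻¹ * (2 * σ * t) = 2 * t := by
        rw [mul_comm 2 σ, mul_assoc, inv_mul_cancel_left₀ hσ]
      have e6 : σ⁻¹ • fderiv ℝ (u t) (x + c) (σ • x + A x) = fderiv ℝ (u t) (x + c) (x + A' x) := by
        rw [← (fderiv ℝ (u t) (x + c)).map_smul]
        congr 1
        rw [hA'def, smul_apply, smul_add, smul_smul, inv_mul_cancel₀ hσ, one_smul]
      have e7 : σ⁻¹ • A (u t (x + c)) = A' (u t (x + c)) := by
        rw [hA'def, smul_apply]
      rw [e5, e6, e7] at k2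
      exact k2
    -- conclude on the translated field (stub 5), then translate back
    have hzero : ∀ t < 0, ∀ x, (fun t x => u t (x + c)) t x = 0 :=
      h5 C (fun t x => u t (x + c)) hv A' hA' hLv
    have := hzero t ht (x - c)
    simpa only [sub_add_cancel] using this

/-- The crux itself, from the registered stubs (and the route item `AxisymEndLiouville` as a hypothesis). -/
theorem SymmetricLiouville_proof (hAx : AxisymEndLiouville) : SymmetricLiouville :=
  SymmetricLiouville_of stub_screwIsPeriodic stub_classCompactness stub_rotationCovariance
    stub_periodicBlowdownVanishing stub_smallAtMinusInfinityLiouville hAx stub_selfSimilarLeaf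
    stub_rotatedSelfSimilarLiouville

/-- Route item `HelicalEndLiouville` (stmt-14062) from the registered stubs. -/
theorem HelicalEndLiouville_proof : HelicalEndLiouville :=
  HelicalEndLiouville_of stub_screwIsPeriodic stub_classCompactness stub_rotationCovariance
    stub_periodicBlowdownVanishing stub_smallAtMinusInfinityLiouville

/-! ## Position lemmas (sorry-free): the leaf statements are not stronger than the crux -/

/-- The crux implies the periodic leaf (specialisation `σ = 0`). -/
theorem symmetricLiouville_implies_periodicLeaf : SymmetricLiouville → Sig.periodicLeaf := by
  intro h C u hcl a A hA hra hK
  refine h C u (isTypeIAncientMild_iff.1 hcl) a 0 A hA ?_ ?_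
  · rintro ⟨rfl, -, rfl⟩
    exact hra ⟨0, by simp⟩
  · intro t ht x
    simpa only [zero_smul, add_zero, mul_zero, zero_mul] using hK t ht x

/-- The crux implies the foreign stub 5 (specialisation `a = 0`, `σ = 1`). -/
theorem symmetricLiouville_implies_spiralScalingLiouville :
    SymmetricLiouville → Sig.stub_spiralScalingLiouville := by
  intro h C u hcl A hA hL
  refine h C u (isTypeIAncientMild_iff.1 hcl) 0 1 A hA (fun hz => one_ne_zero hz.2.1) ?_
  intro t ht x
  simpa only [zero_add, one_smul, mul_one] using hL t ht x

/-- The crux implies the open core stub 5b (specialisation `a = 0`, `σ = 1`, `A ≠ 0`). -/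
theorem symmetricLiouville_implies_rotatedSelfSimilarLiouville :
    SymmetricLiouville → Sig.stub_rotatedSelfSimilarLiouville :=
  fun h C u hcl A hA _ hL => symmetricLiouville_implies_spiralScalingLiouville h C u hcl A hA hL

end Summit.NavierStokesRegularity.NavierStokesRegularity.Theorems.SymmetryModuliCountSymmetricLiouville

end
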